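import Literature.Geometry.Kaehler.ComplexTorusSimpleLefschetzLieAlgebraSemisimple
import Literature.Geometry.Kaehler.ComplexTorusLefschetzLieAlgebraRatIsogenyFactors
import HarnessLib

/-!
# «If `X` has no factors of Type IV then `Hg(X)` is semi-simple», and the converse for `S(X)`: for a polarised complex torus
# `X ∼ ∏ₖ B_k^{n_k}`, Milne's `Lie S(X)` is semisimple over `ℚ` IFF every simple factor `B_k` has totally real centre

Layer `Literature/Geometry/Kaehler`, namespace `Literature.Geometry.Kaehler.ComplexTorus`; lane `lit-hodgefound` (Track 2
foundations library); prover seat `lit-hodgefound-p17`, generation 60, self-proposed row g60-#3 — the FACTOR-LEVEL form of ✔ g60-#1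
(`ComplexTorusSimpleLefschetzLieAlgebraSemisimple`: for `B` SIMPLE, `𝔷(Lie S(B)) = 0` ⟺ the centre of `End_ℚ(B)` is totally real),
carried to an arbitrary polarised torus through p36's Prop. 1.5 at the `ℚ`-Lie algebra
(`ComplexTorusLefschetzLieAlgebraRatIsogenyFactors`: `Lie S(X) ≃ₗ⁅ℚ⁆ ⨁ₖ Lie S(B_k)`) and p36's reductivity
(`IsRiemannForm.isSemisimple_lefschetzLieRat_iff_center_eq_bot`).  THEOREMS ONLY (no definition, no instance, no notation, no
named fact; D-0026 net debt `0`).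

## Sources, VERBATIM

* B. Moonen, Yu. G. Zarhin [MoonenZarhin1999LowDim], *Hodge classes on abelian varieties of low dimension*, Math. Ann. **315**
  (1999) (held `paper:arxiv-math_9901113`), §1 (p0002 L134–L136): «The Hodge group `Hg(X)` is a torus if and only if `X` is of
  CM-type.  If `X` has no factors of Type 4 then `Hg(X)` is semi-simple.»; (p0002) «We say that a (simple) abelian variety `X` is
  of Type `A` … if `End⁰(X)` is an algebra of the corresponding type» with «Type 4(`e₀,d`): `e = 2e₀`; `F` is a CM-field».
* J. S. Milne [Milne1999LefschetzClasses], Duke Math. J. **96** (1999) (held `paper:doi-10-1215-s0012-7094-99-09620-5`), §1 Prop. 1.5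
  (p. 644): «Any such isogeny induces an isomorphism `S(A₁) × ⋯ × S(A_s) → S(A)`»; p. 645: «`C₀(A)` … is a product of fields, each
  of which is either a CM-field or [totally real] … `S₀(A)(R) = {γ ∈ C₀(A) ⊗_ℚ R ∣ γ†γ = 1}`»; §2 p. 646: «`K` equals `F` except when
  `A` is of type IV»; Summary table p. 652 (column «Semisimple»: I ∕ II ∕ III Yes, IV No).
* N. Bourbaki [Bourbaki1989LieGroups13], *Lie Groups and Lie Algebras* Ch. I §6 no. 4 Prop. 5 (reductive: semisimple ⟺ centre `0`)
  and §1 no. 1 (product Lie algebras: the bracket, hence the centre, is computed componentwise).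

## What is proved

* §1 (Lie-algebra plumbing, any commutative ring): `center_eq_bot_iff_of_lieEquiv` (`𝔷(L) = 0 ⟺ 𝔷(L') = 0` along `L ≃ₗ⁅R⁆ L'`) and
  **`center_directSum_eq_bot_iff`** (`𝔷(⨁ₖ L_k) = 0 ⟺ ∀ k, 𝔷(L_k) = 0`).
* §2 `X ∼ ∏ₖ B_k^{n_k}` (`B_k` simple, pairwise non-isogenous, polarised; `n_k ≥ 1`): **`IsIsogenous.center_lefschetzLieRat_eq_bot_iff_forall_isTotallyReal`**,
  **`IsIsogenous.isSemisimple_lefschetzLieRat_iff_forall_isTotallyReal`** (`Lie S(X)` SEMISIMPLE ⟺ EVERY `B_k` HAS TOTALLY REAL CENTRE,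
  i.e. no factor of type IV), `IsIsogenous.isSemisimple_lefschetzLieRat_iff_forall_not_isCMField`, the `𝔩𝔣` form, the sufficiency
  `IsIsogenous.isSemisimple_lefschetzLieRat_of_forall_isTotallyReal`, and MOONEN–ZARHIN'S SENTENCE
  **`IsIsogenous.isSemisimple_hodgeGroupLieRat_of_forall_isTotallyReal`** (no factor of type IV ⟹ `Lie Hg(X)` semisimple over `ℚ`, via
  `𝔷(𝔥𝔤_ℝ) ⊆ 𝔷(𝔩𝔣)`), with the necessity `IsIsogenous.not_isSemisimple_lefschetzLieRat_of_isCMField` (one CM-centred factor kills it).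
* §3 the literal product `X = ∏ₖ B_k^{n_k}` (`sigmaPiPeriod fun k ↦ powPeriod (Ψ k) (n k)` with its product polarisation):
  `isSemisimple_lefschetzLieRat_sigmaPi_pow_iff_forall_isTotallyReal`.

NOT here: the converse of Moonen–Zarhin's sentence fails (`Hg` can be semisimple with a type IV factor, e.g. Weil type) and is not
claimed; «`Hg(X)` is a torus iff CM-type» is the tree's `ComplexTorusHodgeGroupCommutative` circle.
-/

noncomputable section

open scoped Matrix DirectSum Kronecker
open Module Matrix Complex Function NumberField

namespace Literature.Geometry.Kaehler

namespace ComplexTorus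

/-! ## §1 Centres along Lie equivalences and of direct sums -/

section LiePlumbing

variable {R : Type*} [CommRing R] {L L' : Type*} [LieRing L] [LieAlgebra R L] [LieRing L'] [LieAlgebra R L']

/-- `𝔷(L) = 0 ⟹ 𝔷(L') = 0` along a Lie algebra isomorphism. [cite: Bourbaki1989LieGroups13, Ch. I §1 no. 2 (isomorphisms) and §6 no. 4] -/
private theorem center_eq_bot_of_lieEquiv (e : L ≃ₗ⁅R⁆ L') (h : LieAlgebra.center R L = ⊥) : LieAlgebra.center R L' = ⊥ := by
  rw [LieSubmodule.eq_bot_iff] at h ⊢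
  intro x' hx'
  rw [LieModule.mem_maxTrivSubmodule] at hx'
  have hx : e.symm x' ∈ LieAlgebra.center R L := by
    rw [LieModule.mem_maxTrivSubmodule]
    intro y
    apply e.injective
    rw [LieHom.map_lie e.toLieHom, map_zero]
    change ⁅e y, e (e.symm x')⁆ = 0
    rw [e.apply_symm_apply]
    exact hx' (e y)
  rw [← e.apply_symm_apply x', h _ hx, map_zero]

/-- **`𝔷(L) = 0 ⟺ 𝔷(L') = 0` for isomorphic Lie algebras.** [cite: Bourbaki1989LieGroups13, Ch. I §1 no. 2 and §6 no. 4 Prop. 5] -/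
theorem center_eq_bot_iff_of_lieEquiv (e : L ≃ₗ⁅R⁆ L') : LieAlgebra.center R L = ⊥ ↔ LieAlgebra.center R L' = ⊥ :=
  ⟨center_eq_bot_of_lieEquiv e, center_eq_bot_of_lieEquiv e.symm⟩

variable {κ : Type*} [DecidableEq κ] {M : κ → Type*} [∀ k, LieRing (M k)] [∀ k, LieAlgebra R (M k)]

/-- **The centre of a direct sum of Lie algebras vanishes iff every summand has zero centre** (the bracket of `⨁ₖ L_k` is
componentwise). [cite: Bourbaki1989LieGroups13, Ch. I §1 no. 1 (product of Lie algebras) and §6 no. 4] -/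
theorem center_directSum_eq_bot_iff :
    LieAlgebra.center R (⨁ k, M k) = ⊥ ↔ ∀ k, LieAlgebra.center R (M k) = ⊥ := by
  constructor
  · intro h k
    rw [LieSubmodule.eq_bot_iff] at h ⊢
    intro z hz
    rw [LieModule.mem_maxTrivSubmodule] at hz
    have hc : DirectSum.of M k z ∈ LieAlgebra.center R (⨁ k, M k) := by
      rw [LieModule.mem_maxTrivSubmodule]
      intro y
      ext j
      rw [DirectSum.bracket_apply, DirectSum.zero_apply]
      by_cases hj : j = k
      · subst hj
        rw [DirectSum.of_eq_same]
        exact hz (y j)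
      · rw [DirectSum.of_eq_of_ne _ _ _ hj, lie_zero]
    have h0 := h _ hc
    rw [← DirectSum.of_eq_same (β := M) k z, h0, DirectSum.zero_apply]
  · intro h
    rw [LieSubmodule.eq_bot_iff]
    intro x hx
    rw [LieModule.mem_maxTrivSubmodule] at hx
    ext k
    rw [DirectSum.zero_apply]
    have hk : x k ∈ LieAlgebra.center R (M k) := by
      rw [LieModule.mem_maxTrivSubmodule]
      intro w
      have := congrArg (fun v ↦ v k) (hx (DirectSum.of M k w))
      simpa only [DirectSum.bracket_apply, DirectSum.of_eq_same, DirectSum.zero_apply] using this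
    have h' := h k
    rw [LieSubmodule.eq_bot_iff] at h'
    exact h' _ hk

end LiePlumbing

/-! ## §2 `Lie S(X)` semisimple ⟺ every simple isogeny factor has totally real centre -/

section Factors

variable {ι : Type} [Fintype ι] [DecidableEq ι] {E : Type} [NormedAddCommGroup E] [NormedSpace ℂ E] [FiniteDimensional ℂ E]
  {Φ : (ι → ℝ) ≃L[ℝ] E} {η : E [⋀^Fin 2]→L[ℝ] ℝ} {G₀ : Matrix ι ι ℚ}
  {κ : Type} [Fintype κ] [DecidableEq κ] {σ : κ → Type} [∀ k, Fintype (σ k)] [∀ k, DecidableEq (σ k)] [∀ k, Nonempty (σ k)]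
  {F : κ → Type} [∀ k, NormedAddCommGroup (F k)] [∀ k, NormedSpace ℂ (F k)] [∀ k, FiniteDimensional ℂ (F k)]
  {Ψ : ∀ k, (σ k → ℝ) ≃L[ℝ] F k} {ω : ∀ k, F k [⋀^Fin 2]→L[ℝ] ℝ} {G : ∀ k, Matrix (σ k) (σ k) ℚ} {n : κ → ℕ}

omit [FiniteDimensional ℂ E] in
/-- **`𝔷(Lie S(X)) = 0` ⟺ every simple factor `B_k` has totally real centre**, for `X ∼ ∏ₖ B_k^{n_k}` with simple pairwise
non-isogenous polarised `B_k`, `n_k ≥ 1` (`𝔷(Lie S(X)) ≅ ⨁ₖ 𝔷(Lie S(B_k))` through Prop. 1.5, and ✔ g60-#1 on each factor).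
[cite: Milne1999LefschetzClasses, §1 Prop. 1.5 and p. 645 («`S₀(A)`»), §2 p. 646] [cite: MoonenZarhin1999LowDim, §1] -/
theorem IsIsogenous.center_lefschetzLieRat_eq_bot_iff_forall_isTotallyReal (hη : IsRiemannForm Φ η)
    (hG₀ : G₀.map (Rat.cast : ℚ → ℝ) = latticeGram Φ η) (h : ∀ k, IsRiemannForm (Ψ k) (ω k))
    (hG : ∀ k, (G k).map (Rat.cast : ℚ → ℝ) = latticeGram (Ψ k) (ω k)) (hs : ∀ k, IsSimple (Ψ k))
    (hni : ∀ k l, k ≠ l → ¬ IsIsogenous (Ψ k) (Ψ l)) (hn : ∀ k, 0 < n k)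
    (hX : IsIsogenous Φ (sigmaPiPeriod fun k ↦ powPeriod (Ψ k) (n k))) :
    LieAlgebra.center ℚ ↥(lefschetzLieRat Φ G₀) = ⊥ ↔ ∀ k, IsTotallyReal (centerField (Ψ k) (hs k)) := by
  obtain ⟨e⟩ := hX.nonempty_lefschetzLieRat_lieEquiv_directSum_of_powers hη hG₀ h hG hs hni hn
  rw [center_eq_bot_iff_of_lieEquiv e, center_directSum_eq_bot_iff]
  exact forall_congr' fun k ↦ (hs k).center_lefschetzLieRat_eq_bot_iff_isTotallyReal (h k) (hG k)

/-- **`Lie S(X)` IS SEMISIMPLE OVER `ℚ` IFF EVERY SIMPLE ISOGENY FACTOR OF `X` HAS TOTALLY REAL CENTRE (no factor of type IV)**, for a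
polarised complex torus `X ∼ ∏ₖ B_k^{n_k}` (`B_k` simple, pairwise non-isogenous, polarised; `n_k ≥ 1`).
[cite: Milne1999LefschetzClasses, §1 («a reductive group … over `k`»), Prop. 1.5, §2 p. 646 and Summary table p. 652 (column «Semisimple»)]
[cite: MoonenZarhin1999LowDim, §1 («If `X` has no factors of Type 4 then `Hg(X)` is semi-simple»)] [cite: Bourbaki1989LieGroups13, Ch. I §6 no. 4 Prop. 5] -/
theorem IsIsogenous.isSemisimple_lefschetzLieRat_iff_forall_isTotallyReal (hη : IsRiemannForm Φ η)
    (hG₀ : G₀.map (Rat.cast : ℚ → ℝ) = latticeGram Φ η) (h : ∀ k, IsRiemannForm (Ψ k) (ω k))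
    (hG : ∀ k, (G k).map (Rat.cast : ℚ → ℝ) = latticeGram (Ψ k) (ω k)) (hs : ∀ k, IsSimple (Ψ k))
    (hni : ∀ k l, k ≠ l → ¬ IsIsogenous (Ψ k) (Ψ l)) (hn : ∀ k, 0 < n k)
    (hX : IsIsogenous Φ (sigmaPiPeriod fun k ↦ powPeriod (Ψ k) (n k))) :
    LieAlgebra.IsSemisimple ℚ ↥(lefschetzLieRat Φ G₀) ↔ ∀ k, IsTotallyReal (centerField (Ψ k) (hs k)) := by
  rw [hη.isSemisimple_lefschetzLieRat_iff_center_eq_bot hG₀]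
  exact hX.center_lefschetzLieRat_eq_bot_iff_forall_isTotallyReal hη hG₀ h hG hs hni hn

/-- A CM field is not totally real. [folklore] -/
private theorem not_isTotallyReal_of_isCMField₆₀₃ (K : Type*) [Field K] [NumberField K] [IsCMField K] : ¬ IsTotallyReal K := by
  intro hK
  apply IsCMField.complexConj_ne_one K
  ext x
  rw [AlgEquiv.one_apply]
  exact (IsCMField.complexConj_eq_self_iff (K := K) x).2 (IsTotallyReal.maximalRealSubfield_eq_top (K := K) ▸ Subfield.mem_top x)

/-- `Lie S(X)` semisimple ⟺ NO simple factor has a CM centre (Shimura Prop. 5: each centre is totally real or CM).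
[cite: Milne1999LefschetzClasses, §2 p. 646 («`K` equals `F` except when `A` is of type IV, in which case it is a CM-field»)] [cite: Shimura1998, §5.1 Prop. 5 (p. 36)] -/
theorem IsIsogenous.isSemisimple_lefschetzLieRat_iff_forall_not_isCMField (hη : IsRiemannForm Φ η)
    (hG₀ : G₀.map (Rat.cast : ℚ → ℝ) = latticeGram Φ η) (h : ∀ k, IsRiemannForm (Ψ k) (ω k))
    (hG : ∀ k, (G k).map (Rat.cast : ℚ → ℝ) = latticeGram (Ψ k) (ω k)) (hs : ∀ k, IsSimple (Ψ k))
    (hni : ∀ k l, k ≠ l → ¬ IsIsogenous (Ψ k) (Ψ l)) (hn : ∀ k, 0 < n k)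
    (hX : IsIsogenous Φ (sigmaPiPeriod fun k ↦ powPeriod (Ψ k) (n k))) :
    LieAlgebra.IsSemisimple ℚ ↥(lefschetzLieRat Φ G₀) ↔ ∀ k, ¬ IsCMField (centerField (Ψ k) (hs k)) := by
  rw [hX.isSemisimple_lefschetzLieRat_iff_forall_isTotallyReal hη hG₀ h hG hs hni hn]
  refine forall_congr' fun k ↦ ⟨fun hK hCM ↦ not_isTotallyReal_of_isCMField₆₀₃ _ hK, fun hK ↦ ?_⟩
  exact ((hs k).centerField_isTotallyReal_or_isCMField (h k)).resolve_right hK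

/-- The real form: `𝔩𝔣 = Lie Lf(X)(ℝ)` semisimple over `ℝ` ⟺ every simple factor has totally real centre.
[cite: Milne1999LefschetzClasses, Prop. 1.5 and Summary table p. 652] [cite: Bourbaki1989LieGroups13, Ch. I §6 no. 10] -/
theorem IsIsogenous.isSemisimple_lefschetzLie_iff_forall_isTotallyReal (hη : IsRiemannForm Φ η)
    (hG₀ : G₀.map (Rat.cast : ℚ → ℝ) = latticeGram Φ η) (h : ∀ k, IsRiemannForm (Ψ k) (ω k))
    (hG : ∀ k, (G k).map (Rat.cast : ℚ → ℝ) = latticeGram (Ψ k) (ω k)) (hs : ∀ k, IsSimple (Ψ k))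
    (hni : ∀ k l, k ≠ l → ¬ IsIsogenous (Ψ k) (Ψ l)) (hn : ∀ k, 0 < n k)
    (hX : IsIsogenous Φ (sigmaPiPeriod fun k ↦ powPeriod (Ψ k) (n k))) :
    LieAlgebra.IsSemisimple ℝ ↥(lefschetzLie Φ G₀) ↔ ∀ k, IsTotallyReal (centerField (Ψ k) (hs k)) := by
  rw [← isSemisimple_lefschetzLieRat_iff_isSemisimple_lefschetzLie Φ G₀]
  exact hX.isSemisimple_lefschetzLieRat_iff_forall_isTotallyReal hη hG₀ h hG hs hni hn

/-- **NO FACTOR OF TYPE IV ⟹ `Lie S(X)` SEMISIMPLE.** [cite: Milne1999LefschetzClasses, Prop. 1.5 and §2 Summary table p. 652 (I ∕ II ∕ III: «Semisimple: Yes»)]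
[cite: MoonenZarhin1999LowDim, §1] -/
theorem IsIsogenous.isSemisimple_lefschetzLieRat_of_forall_isTotallyReal (hη : IsRiemannForm Φ η)
    (hG₀ : G₀.map (Rat.cast : ℚ → ℝ) = latticeGram Φ η) (h : ∀ k, IsRiemannForm (Ψ k) (ω k))
    (hG : ∀ k, (G k).map (Rat.cast : ℚ → ℝ) = latticeGram (Ψ k) (ω k)) (hs : ∀ k, IsSimple (Ψ k))
    (hni : ∀ k l, k ≠ l → ¬ IsIsogenous (Ψ k) (Ψ l)) (hn : ∀ k, 0 < n k)
    (hX : IsIsogenous Φ (sigmaPiPeriod fun k ↦ powPeriod (Ψ k) (n k))) (hK : ∀ k, IsTotallyReal (centerField (Ψ k) (hs k))) :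
    LieAlgebra.IsSemisimple ℚ ↥(lefschetzLieRat Φ G₀) :=
  (hX.isSemisimple_lefschetzLieRat_iff_forall_isTotallyReal hη hG₀ h hG hs hni hn).2 hK

/-- **ONE FACTOR OF TYPE IV KILLS SEMISIMPLICITY**: if some simple factor `B_k` has a CM centre, `Lie S(X)` is not semisimple (its centre
contains `𝔷(Lie S(B_k)) ∋ θ`, `θ̄ = −θ`). [cite: Milne1999LefschetzClasses, p. 645 («`S₀(A)`»), Prop. 1.5 and Summary table p. 652 (IV: «Semisimple: No»)] -/
theorem IsIsogenous.not_isSemisimple_lefschetzLieRat_of_isCMField (hη : IsRiemannForm Φ η)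
    (hG₀ : G₀.map (Rat.cast : ℚ → ℝ) = latticeGram Φ η) (h : ∀ k, IsRiemannForm (Ψ k) (ω k))
    (hG : ∀ k, (G k).map (Rat.cast : ℚ → ℝ) = latticeGram (Ψ k) (ω k)) (hs : ∀ k, IsSimple (Ψ k))
    (hni : ∀ k l, k ≠ l → ¬ IsIsogenous (Ψ k) (Ψ l)) (hn : ∀ k, 0 < n k)
    (hX : IsIsogenous Φ (sigmaPiPeriod fun k ↦ powPeriod (Ψ k) (n k))) (k : κ) [IsCMField (centerField (Ψ k) (hs k))] :
    ¬ LieAlgebra.IsSemisimple ℚ ↥(lefschetzLieRat Φ G₀) := by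
  rw [hX.isSemisimple_lefschetzLieRat_iff_forall_not_isCMField hη hG₀ h hG hs hni hn, not_forall]
  exact ⟨k, not_not.2 ‹_›⟩

/-- **MOONEN–ZARHIN: «If `X` has no factors of Type 4 then `Hg(X)` is semi-simple»** — at the `ℚ`-Lie algebra `Lie Hg(X) = hodgeGroupLieRat`:
if every simple factor of `X ∼ ∏ₖ B_k^{n_k}` has totally real centre then `Lie Hg(X)` is semisimple over `ℚ` (`𝔷(𝔥𝔤_ℝ) ⊆ 𝔷(𝔩𝔣) = 0`,
p36). [cite: MoonenZarhin1999LowDim, §1 (p0002: «If `X` has no factors of Type 4 then `Hg(X)` is semi-simple.»)]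
[cite: Milne1999LefschetzClasses, §4 («`Hg(A) ⊂ L(A)`»)] -/
theorem IsIsogenous.isSemisimple_hodgeGroupLieRat_of_forall_isTotallyReal (hη : IsRiemannForm Φ η)
    (hG₀ : G₀.map (Rat.cast : ℚ → ℝ) = latticeGram Φ η) (h : ∀ k, IsRiemannForm (Ψ k) (ω k))
    (hG : ∀ k, (G k).map (Rat.cast : ℚ → ℝ) = latticeGram (Ψ k) (ω k)) (hs : ∀ k, IsSimple (Ψ k))
    (hni : ∀ k l, k ≠ l → ¬ IsIsogenous (Ψ k) (Ψ l)) (hn : ∀ k, 0 < n k)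
    (hX : IsIsogenous Φ (sigmaPiPeriod fun k ↦ powPeriod (Ψ k) (n k))) (hK : ∀ k, IsTotallyReal (centerField (Ψ k) (hs k))) :
    LieAlgebra.IsSemisimple ℚ ↥(hodgeGroupLieRat Φ) :=
  (isSemisimple_hodgeGroupLieRat_iff_isSemisimple_hodgeGroupLie Φ).2 (hη.isSemisimple_hodgeGroupLie_of_isSemisimple_lefschetzLie hG₀
    ((hX.isSemisimple_lefschetzLie_iff_forall_isTotallyReal hη hG₀ h hG hs hni hn).2 hK))

/-- Moonen–Zarhin's sentence for the real Lie algebra `𝔥𝔤_ℝ = Lie Hg(X)(ℝ)`. [cite: MoonenZarhin1999LowDim, §1] -/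
theorem IsIsogenous.isSemisimple_hodgeGroupLie_of_forall_isTotallyReal (hη : IsRiemannForm Φ η)
    (hG₀ : G₀.map (Rat.cast : ℚ → ℝ) = latticeGram Φ η) (h : ∀ k, IsRiemannForm (Ψ k) (ω k))
    (hG : ∀ k, (G k).map (Rat.cast : ℚ → ℝ) = latticeGram (Ψ k) (ω k)) (hs : ∀ k, IsSimple (Ψ k))
    (hni : ∀ k l, k ≠ l → ¬ IsIsogenous (Ψ k) (Ψ l)) (hn : ∀ k, 0 < n k)
    (hX : IsIsogenous Φ (sigmaPiPeriod fun k ↦ powPeriod (Ψ k) (n k))) (hK : ∀ k, IsTotallyReal (centerField (Ψ k) (hs k))) :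
    LieAlgebra.IsSemisimple ℝ ↥(hodgeGroupLie Φ) :=
  hη.isSemisimple_hodgeGroupLie_of_isSemisimple_lefschetzLie hG₀
    ((hX.isSemisimple_lefschetzLie_iff_forall_isTotallyReal hη hG₀ h hG hs hni hn).2 hK)

end Factors

/-! ## §3 The literal product `X = ∏ₖ B_k^{n_k}` -/

section Literal

variable {κ : Type} [Fintype κ] [DecidableEq κ] {σ : κ → Type} [∀ k, Fintype (σ k)] [∀ k, DecidableEq (σ k)] [∀ k, Nonempty (σ k)]
  {F : κ → Type} [∀ k, NormedAddCommGroup (F k)] [∀ k, NormedSpace ℂ (F k)] [∀ k, FiniteDimensional ℂ (F k)]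
  {Ψ : ∀ k, (σ k → ℝ) ≃L[ℝ] F k} {ω : ∀ k, F k [⋀^Fin 2]→L[ℝ] ℝ} {G : ∀ k, Matrix (σ k) (σ k) ℚ} {n : κ → ℕ}

/-- **`Lie S(∏ₖ B_k^{n_k})` (product polarisation) is semisimple ⟺ every `B_k` has totally real centre** (`B_k` simple pairwise
non-isogenous polarised, `n_k ≥ 1`). [cite: Milne1999LefschetzClasses, Prop. 1.5 and Summary table p. 652] [cite: MoonenZarhin1999LowDim, §1] -/
theorem isSemisimple_lefschetzLieRat_sigmaPi_pow_iff_forall_isTotallyReal (h : ∀ k, IsRiemannForm (Ψ k) (ω k))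
    (hG : ∀ k, (G k).map (Rat.cast : ℚ → ℝ) = latticeGram (Ψ k) (ω k)) (hs : ∀ k, IsSimple (Ψ k))
    (hni : ∀ k l, k ≠ l → ¬ IsIsogenous (Ψ k) (Ψ l)) (hn : ∀ k, 0 < n k) :
    LieAlgebra.IsSemisimple ℚ ↥(lefschetzLieRat (sigmaPiPeriod fun k ↦ powPeriod (Ψ k) (n k))
        (Matrix.blockDiagonal' fun k ↦ (1 : Matrix (Fin (n k)) (Fin (n k)) ℚ) ⊗ₖ G k)) ↔
      ∀ k, IsTotallyReal (centerField (Ψ k) (hs k)) :=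
  (IsIsogenous.refl _).isSemisimple_lefschetzLieRat_iff_forall_isTotallyReal (IsRiemannForm.sigmaPi fun k ↦ (h k).pow (n k))
    (blockDiagonal'_one_kronecker_map_ratCast_eq_latticeGram_sigmaPi_pow hG) h hG hs hni hn

end Literal

end ComplexTorus

end Literature.Geometry.Kaehler

end
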